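import Mathlib
import Summits.PneNP.PneNP.Theses.OverlapGapAlgebra
import Summits.PneNP.PneNP.Theorems.OverlapGapAlgebraSolvableImpliesStableSectionEngine

/-!
# Route OverlapGapAlgebra, crux `SearchHardWindow` (stmt-PneNP-2460): the smooth-maps rung

**Bresler–Huang 2021, Theorem 2.6 in the authors' general form ("the only property of low degree
polynomials we use is their smoothness … Theorem 2.6 applies to any algorithm satisfying the
conclusion of Proposition 6.x", arXiv:2106.02129 p. 8), modulo the route's probability crux.**
Assuming `NoStableSection` (stmt-PneNP-2462: the ensemble multi-OGP bound, for ALL maps, on the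
Bresler–Huang resampling path at density `α_k = 5·2^k log k/k`), every map
`g : instances → assignments` of random `k`-SAT (`k ≥ k₀`, no complexity bound whatsoever) obeys the
dichotomy: EITHER its `ηn`-jumps under a single uniformly random literal resampling are frequent —
more than a `c·n/log(2n)/(mk)`-fraction of the (instance, slot, fresh literal) triples — OR it violates
more than `ν m` clauses on more than a `c·n/log(2n)/(km)`-fraction of the instances. In particular
no `O(1/log n)`-average-stable map `ν`-satisfies `F_k(n, ⌊α_k n⌋)` with probability `1 − o(1/log n)`:
the abstract "stable algorithms fail in the OGP window" statement behind the crux's hardness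
predicate, here for the class of smooth maps.

Mechanism: the accepted ENGINE of crux `SolvableImpliesStableSection`
(`Cruxes.SolvableImpliesStableSection.Sketch.engine_count`, Bresler–Huang Lemma 6.5: a smooth map that
is valid off a sparse set survives the whole lazy resampling path with probability
`≥ (2n)^{-4kA} − (2n)^{-k²m}`) against the `e^{-cn}` ceiling of `NoStableSection`, with the
stability budget `A := (c/(8k))·n/log(2n)` so that `(2n)^{-4kA} = e^{-cn/2}`.

References: G. Bresler, B. Huang, *The algorithmic phase transition of random k-SAT for low degree
polynomials*, FOCS 2021 / arXiv:2106.02129, Thm. 2.6, remark p. 8, Lemma 6.5 [BreslerHuang2022];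
D. Gamarnik, *The overlap gap property: a topological barrier to optimizing over random
structures*, PNAS 118 (2021) [Gamarnik2021].
-/

namespace Summit.PneNP.PneNP.Theorems

set_option linter.dupNamespace false -- `Summit.PneNP.PneNP.…`: summit = sub-problem (D-0017)

open Finset Filter
open Summit.PneNP.PneNP.Theses.OverlapGapAlgebra
open Summit.PneNP.PneNP.Cruxes.SolvableImpliesStableSection.Sketch
open scoped Classical

/-- The window density dominates `1`: `1 ≤ 5·2^k·log k/k` for `k ≥ 3`. -/
theorem smoothMaps_one_le_density {k : ℕ} (hk : 3 ≤ k) :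
    (1 : ℝ) ≤ 5 * 2 ^ k * Real.log k / k := by
  have hkpos : (0 : ℝ) < k := by exact_mod_cast (by omega : 0 < k)
  have hlog2 : (0.6931471803 : ℝ) < Real.log 2 := Real.log_two_gt_d9
  have hlogk : Real.log 2 ≤ Real.log k :=
    Real.log_le_log (by norm_num) (by exact_mod_cast (by omega : 2 ≤ k))
  have hpow : (k : ℝ) ≤ 2 ^ k := by exact_mod_cast (Nat.lt_two_pow_self).le
  rw [le_div_iff₀ hkpos, one_mul]
  have h2k : (0 : ℝ) ≤ 2 ^ k := by positivity
  nlinarith [mul_le_mul_of_nonneg_left (hlog2.le.trans hlogk) h2k]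

/-- At the window density the number of clauses dominates the number of variables:
`n ≤ ⌊5·2^k·log k/k · n⌋₊` for `k ≥ 3`. -/
theorem smoothMaps_le_numClauses {k : ℕ} (hk : 3 ≤ k) (n : ℕ) :
    n ≤ ⌊5 * 2 ^ k * Real.log k / k * n⌋₊ := by
  refine Nat.le_floor ?_
  have h := smoothMaps_one_le_density hk
  have hn : (0 : ℝ) ≤ n := Nat.cast_nonneg n
  nlinarith

/-- The final arithmetic of the rung: for `n ≥ 1` with `log n ≥ c/2 + 1` and
`e^{-cn/2} ≤ 1/2`, and an exponent `N ≥ n`, the engine's lower bound `(2n)^{M+N} e^{-cn/2} - (2n)^M`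
exceeds the ceiling `e^{-cn} (2n)^{M+N}`. -/
theorem smoothMaps_arith {c : ℝ} {n M N : ℕ} (hn : 1 ≤ n)
    (hlog : c / 2 + 1 ≤ Real.log n) (hhalf : Real.exp (-(c * n / 2)) ≤ 1 / 2) (hN : n ≤ N) :
    Real.exp (-(c * n)) * ((2 * n : ℝ) ^ M * (2 * n : ℝ) ^ N) <
      (2 * n : ℝ) ^ M * (2 * n : ℝ) ^ N * Real.exp (-(c * n / 2)) - (2 * n : ℝ) ^ M := by
  have hn1 : (1 : ℝ) ≤ n := by exact_mod_cast hn
  have h2n1 : (1 : ℝ) ≤ 2 * n := by linarith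
  have hX : (0 : ℝ) < (2 * n : ℝ) ^ M := by positivity
  set e₁ : ℝ := Real.exp (-(c * n / 2)) with he₁
  have he₁pos : 0 < e₁ := Real.exp_pos _
  have he₂ : Real.exp (-(c * n)) = e₁ * e₁ := by
    rw [he₁, ← Real.exp_add]; congr 1; ring
  -- `(2n)^N e₁ ≥ (2n)^n e₁ = exp (n (log (2n) - c/2)) ≥ exp n ≥ e > 2`
  have hlog2n : Real.log n ≤ Real.log (2 * n) :=
    Real.log_le_log (by linarith) (by linarith)
  have hYn : (2 * n : ℝ) ^ n * e₁ = Real.exp (n * (Real.log (2 * n) - c / 2)) := by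
    rw [he₁, ← Real.rpow_natCast, Real.rpow_def_of_pos (by linarith), ← Real.exp_add]
    congr 1; ring
  have hbig : (2 : ℝ) < (2 * n : ℝ) ^ n * e₁ := by
    rw [hYn]
    have h1 : (n : ℝ) * 1 ≤ n * (Real.log (2 * n) - c / 2) :=
      mul_le_mul_of_nonneg_left (by linarith) (by linarith)
    have h2 : Real.exp 1 ≤ Real.exp (n * (Real.log (2 * n) - c / 2)) :=
      Real.exp_le_exp.2 (by linarith)
    have h3 : (2 : ℝ) < Real.exp 1 := by
      have := Real.exp_one_gt_d9; linarith
    linarith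
  have hYN : (2 * n : ℝ) ^ n * e₁ ≤ (2 * n : ℝ) ^ N * e₁ :=
    mul_le_mul_of_nonneg_right (pow_le_pow_right₀ h2n1 hN) he₁pos.le
  -- hence `(2n)^N (e₁ - e₁²) > 1`
  have hkey : (1 : ℝ) < (2 * n : ℝ) ^ N * (e₁ - e₁ * e₁) := by
    have hP : (2 : ℝ) < (2 * n : ℝ) ^ N * e₁ := lt_of_lt_of_le hbig hYN
    have h1e : (1 : ℝ) / 2 ≤ 1 - e₁ := by linarith
    have hpos : (0 : ℝ) ≤ (2 * n : ℝ) ^ N * e₁ := by positivity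
    have hprod := mul_le_mul_of_nonneg_left h1e hpos
    nlinarith [hprod, hP]
  -- multiply through by `(2n)^M > 0`
  rw [he₂]
  nlinarith [mul_lt_mul_of_pos_left hkey hX]

/-- **Smooth maps fail at the window density (Bresler–Huang 2021 Thm. 2.6, general form), modulo
`NoStableSection`.** Assume the route's probability crux `NoStableSection` (stmt-PneNP-2462). Then
there is `k₀` such that for every `k ≥ k₀` there are `η, ν, c > 0` with: for all large `n`, with
`m = ⌊5·2^k·log k/k · n⌋₊`, for EVERY map `g` from instances `Fin m → Fin k → Fin n × Bool` to
assignments `Fin n → Bool`, if the number of (instance `Φ`, slot `(a,b)`, fresh literal `ℓ`) triples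
on which replacing the literal of `Φ` in slot `(a,b)` by `ℓ` moves `g` by more than `η n` in Hamming
distance is at most `(c·n/log(2n)) · #instances · 2n` (i.e. a `c·n/((mk) log(2n)) = O_k(1/log n)`
fraction of all triples), then `g` violates more than `ν m` clauses on more than
`(c·n/log(2n))/(k m) · #instances` instances (an `Ω_k(1/log n)` fraction). Proof: otherwise the
engine `engine_count` (valid off a sparse set + smooth ⇒ the whole resampling path is `ν`-valid and
`ηn`-stable with probability `≥ (2n)^{-4kA} − (2n)^{-k²m}`, `A = (c₀/(8k)) n/log(2n)`, so
`(2n)^{-4kA} = e^{-c₀ n/2}`) contradicts the ceiling `e^{-c₀ n}` of `NoStableSection`.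
[BreslerHuang2022, Thm. 2.6 and remark p. 8, Lemma 6.5] -/
theorem smoothMapsFail_of_noStableSection (hNo : NoStableSection) :
    ∃ k₀ : ℕ, ∀ k : ℕ, k₀ ≤ k → ∃ η : ℝ, 0 < η ∧ ∃ ν : ℝ, 0 < ν ∧ ∃ c : ℝ, 0 < c ∧
      ∀ᶠ n : ℕ in Filter.atTop, ∀ m : ℕ, m = ⌊5 * 2 ^ k * Real.log k / k * n⌋₊ →
        ∀ g : (Fin m → Fin k → Fin n × Bool) → (Fin n → Bool),
          (∑ a : Fin m, ∑ b : Fin k,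
              (((Finset.univ : Finset ((Fin m → Fin k → Fin n × Bool) × (Fin n × Bool))).filter
                fun p => η * n < hammingDist (g p.1)
                  (g (Function.update p.1 a (Function.update (p.1 a) b p.2)))).card : ℝ))
            ≤ c * n / Real.log (2 * n) * (Fintype.card (Fin m → Fin k → Fin n × Bool) * (2 * n)) →
          c * n / Real.log (2 * n) * Fintype.card (Fin m → Fin k → Fin n × Bool) <
            (k * m : ℕ) * ((Finset.univ.filter fun Φ : Fin m → Fin k → Fin n × Bool =>
              ν * m < ((Finset.univ.filter fun i : Fin m =>
                ∀ j, g Φ (Φ i j).1 ≠ (Φ i j).2).card : ℝ)).card : ℝ) := by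
  obtain ⟨k₀, hk₀⟩ := hNo
  refine ⟨max k₀ 3, fun k hk => ?_⟩
  have hk0 : k₀ ≤ k := le_trans (le_max_left _ _) hk
  have hk3 : 3 ≤ k := le_trans (le_max_right _ _) hk
  obtain ⟨η, hη, ν, hν, c₀, hc₀, hev⟩ := hk₀ k hk0
  have hkpos : (0 : ℝ) < k := by exact_mod_cast (by omega : 0 < k)
  refine ⟨η, hη, ν, hν, c₀ / (8 * k), by positivity, ?_⟩
  -- largeness of `n`: the OGP ceiling, `n ≥ 1`, `log n ≥ c₀/2 + 1`, `e^{-c₀ n/2} ≤ 1/2`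
  have hlog : ∀ᶠ n : ℕ in atTop, c₀ / 2 + 1 ≤ Real.log n :=
    (Real.tendsto_log_atTop.comp tendsto_natCast_atTop_atTop).eventually_ge_atTop _
  have hhalf : ∀ᶠ n : ℕ in atTop, Real.exp (-(c₀ * n / 2)) ≤ 1 / 2 := by
    filter_upwards [tendsto_natCast_atTop_atTop.eventually_ge_atTop (2 * Real.log 2 / c₀)] with n hn
    have h1 : Real.log 2 ≤ c₀ * n / 2 := by
      rw [div_le_iff₀ hc₀] at hn; linarith
    calc Real.exp (-(c₀ * n / 2)) ≤ Real.exp (-Real.log 2) := Real.exp_le_exp.2 (by linarith)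
      _ = 1 / 2 := by rw [Real.exp_neg, Real.exp_log (by norm_num), one_div]
  filter_upwards [hev, eventually_ge_atTop 1, hlog, hhalf] with n hNSS hn1 hlogn hhalfn m hm g hjump
  -- the stability budget
  set A : ℝ := c₀ / (8 * k) * n / Real.log (2 * n) with hA
  have hn1' : (1 : ℝ) ≤ n := by exact_mod_cast hn1
  have hlogpos : 0 < Real.log (2 * n) := Real.log_pos (by linarith)
  have hApos : 0 ≤ A := by rw [hA]; positivity
  have hexpA : 4 * k * A * Real.log (2 * n) = c₀ * n / 2 := by
    have hk0' : (k : ℝ) ≠ 0 := hkpos.ne'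
    have hl0 : Real.log (2 * n) ≠ 0 := hlogpos.ne'
    rw [hA, mul_assoc, div_mul_cancel₀ _ hl0]
    field_simp
    ring
  by_contra hcon
  rw [not_lt] at hcon
  -- the valid set `G` and the sparseness of its complement
  set G : Finset (Fin m → Fin k → Fin n × Bool) := Finset.univ.filter fun Φ =>
    ((Finset.univ.filter fun i : Fin m => ∀ j, g Φ (Φ i j).1 ≠ (Φ i j).2).card : ℝ) ≤ ν * m
    with hGdef
  have hGc : Gᶜ = Finset.univ.filter fun Φ : Fin m → Fin k → Fin n × Bool =>
      ν * m < ((Finset.univ.filter fun i : Fin m => ∀ j, g Φ (Φ i j).1 ≠ (Φ i j).2).card : ℝ) := by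
    ext Φ
    simp only [hGdef, Finset.mem_compl, Finset.mem_filter, Finset.mem_univ, true_and, not_le]
  have hG : ((k * m : ℕ) : ℝ) * (Gᶜ.card : ℝ) ≤ A * Fintype.card (Fin m → Fin k → Fin n × Bool) := by
    rw [hGc]; exact hcon
  -- the engine: many fully valid, stable paths …
  have hE := engine_count k m n hn1 η A hη.le hApos g G hG hjump
  -- … all of which lie in the event bounded by `NoStableSection`
  have hN := hNSS m hm g
  have hsub : ((univ : Finset (Fin (k + 1) → Fin m → Fin k → Fin n × Bool)).filter fun Ψ =>
          (∀ r : Fin k, ∀ q ≤ m * k,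
            (fun (a : Fin m) (b : Fin k) =>
              if (a : ℕ) * k + b < q then Ψ r.succ a b else Ψ r.castSucc a b) ∈ G) ∧
          ∀ r : Fin k, ∀ q < m * k,
            (hammingDist
              (g fun (a : Fin m) (b : Fin k) =>
                if (a : ℕ) * k + b < q then Ψ r.succ a b else Ψ r.castSucc a b)
              (g fun (a : Fin m) (b : Fin k) =>
                if (a : ℕ) * k + b < q + 1 then Ψ r.succ a b else Ψ r.castSucc a b) : ℝ)
              ≤ η * n) ⊆
      ((Finset.univ.filter fun Ψ : Fin (k + 1) → Fin m → Fin k → Fin n × Bool =>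
          let P : Fin k → ℕ → Fin m → Fin k → Fin n × Bool := fun r q a b =>
            if (a : ℕ) * k + b < q then Ψ r.succ a b else Ψ r.castSucc a b
          (∀ r : Fin k, ∀ q ≤ m * k, ((Finset.univ.filter fun i : Fin m =>
              ∀ j, g (P r q) (P r q i j).1 ≠ (P r q i j).2).card : ℝ) ≤ ν * m) ∧
          ∀ r : Fin k, ∀ q < m * k, (hammingDist (g (P r q)) (g (P r (q + 1))) : ℝ) ≤ η * n)) := by
    intro Ψ hΨ
    simp only [hGdef, Finset.mem_filter, Finset.mem_univ, true_and] at hΨ ⊢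
    exact hΨ
  have hcard := Finset.card_le_card hsub
  have hchain : (2 * n : ℝ) ^ (m * k * (k + 1)) * Real.exp (-(4 * k * A * Real.log (2 * n))) -
      (2 * n : ℝ) ^ (m * k) ≤ Real.exp (-(c₀ * n)) * (2 * n : ℝ) ^ (m * k * (k + 1)) := by
    refine hE.trans (le_trans (by exact_mod_cast hcard) (hN.trans_eq ?_))
    rw [eng_card_paths]; push_cast; ring
  -- arithmetic contradiction
  rw [hexpA] at hchain
  have hsplit : (2 * n : ℝ) ^ (m * k * (k + 1)) = (2 * n : ℝ) ^ (m * k) * (2 * n : ℝ) ^ (m * k * k) := by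
    rw [← pow_add]; congr 1; ring
  rw [hsplit] at hchain
  have hmn : n ≤ m := by rw [hm]; exact smoothMaps_le_numClauses hk3 n
  have hNexp : n ≤ m * k * k := by
    calc n ≤ m := hmn
      _ = m * 1 * 1 := by ring
      _ ≤ m * k * k := by gcongr <;> omega
  exact absurd hchain (not_le.2 (smoothMaps_arith hn1 hlogn hhalfn hNexp))

/-- **Lipschitz (worst-case stable) maps fail, modulo `NoStableSection`.** Specialisation of
`smoothMapsFail_of_noStableSection` to maps that move by at most `η n` under EVERY single-literal
change (the deterministic analogue of Gamarnik's "stable algorithms"): such a `g` violates more than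
`ν m` clauses on more than a `(c·n/log(2n))/(km) = Ω_k(1/log n)` fraction of the instances of
`F_k(n, ⌊5·2^k log k/k · n⌋)`, for all large `n`. [BreslerHuang2022, Thm. 2.6; Gamarnik2021] -/
theorem lipschitzMapsFail_of_noStableSection (hNo : NoStableSection) :
    ∃ k₀ : ℕ, ∀ k : ℕ, k₀ ≤ k → ∃ η : ℝ, 0 < η ∧ ∃ ν : ℝ, 0 < ν ∧ ∃ c : ℝ, 0 < c ∧
      ∀ᶠ n : ℕ in Filter.atTop, ∀ m : ℕ, m = ⌊5 * 2 ^ k * Real.log k / k * n⌋₊ →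
        ∀ g : (Fin m → Fin k → Fin n × Bool) → (Fin n → Bool),
          (∀ (Φ : Fin m → Fin k → Fin n × Bool) (a : Fin m) (b : Fin k) (ℓ : Fin n × Bool),
            (hammingDist (g Φ) (g (Function.update Φ a (Function.update (Φ a) b ℓ))) : ℝ) ≤ η * n) →
          c * n / Real.log (2 * n) * Fintype.card (Fin m → Fin k → Fin n × Bool) <
            (k * m : ℕ) * ((Finset.univ.filter fun Φ : Fin m → Fin k → Fin n × Bool =>
              ν * m < ((Finset.univ.filter fun i : Fin m =>
                ∀ j, g Φ (Φ i j).1 ≠ (Φ i j).2).card : ℝ)).card : ℝ) := by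
  obtain ⟨k₀, hk₀⟩ := smoothMapsFail_of_noStableSection hNo
  refine ⟨k₀, fun k hk => ?_⟩
  obtain ⟨η, hη, ν, hν, c, hc, hev⟩ := hk₀ k hk
  refine ⟨η, hη, ν, hν, c, hc, ?_⟩
  filter_upwards [hev] with n hn m hm g hLip
  refine hn m hm g (le_of_eq_of_le ?_ (mul_nonneg (div_nonneg (by positivity) ?_) (by positivity)))
  · refine Finset.sum_eq_zero fun a _ => Finset.sum_eq_zero fun b _ => ?_
    rw [Nat.cast_eq_zero, Finset.card_eq_zero, Finset.filter_eq_empty_iff]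
    exact fun p _ => not_lt.2 (hLip p.1 a b p.2)
  · have := Real.log_natCast_nonneg (2 * n)
    push_cast at this
    exact this

/-- **The rung in the crux's own success language.** Modulo `NoStableSection`: for `k ≥ k₀` and all
large `n`, every `ηn`-Lipschitz map `g` (no complexity bound) outputs an assignment satisfying the
random instance `Φ` of `F_k(n, ⌊5·2^k log k/k · n⌋)` — the success event
`∀ i, ∃ j, g Φ (Φ i j).1 = (Φ i j).2` of `SearchHardWindow` — on fewer than a
`1 − (c·n/log(2n))/(km) = 1 − Ω_k(1/log n)` fraction of the instances (an exactly satisfying output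
violates no clause, so it is `ν`-valid). [BreslerHuang2022, Thm. 2.6] -/
theorem lipschitzMaps_successCount_lt_of_noStableSection (hNo : NoStableSection) :
    ∃ k₀ : ℕ, ∀ k : ℕ, k₀ ≤ k → ∃ η : ℝ, 0 < η ∧ ∃ c : ℝ, 0 < c ∧
      ∀ᶠ n : ℕ in Filter.atTop, ∀ m : ℕ, m = ⌊5 * 2 ^ k * Real.log k / k * n⌋₊ →
        ∀ g : (Fin m → Fin k → Fin n × Bool) → (Fin n → Bool),
          (∀ (Φ : Fin m → Fin k → Fin n × Bool) (a : Fin m) (b : Fin k) (ℓ : Fin n × Bool),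
            (hammingDist (g Φ) (g (Function.update Φ a (Function.update (Φ a) b ℓ))) : ℝ) ≤ η * n) →
          (k * m : ℕ) * ((Finset.univ.filter fun Φ : Fin m → Fin k → Fin n × Bool =>
              ∀ i, ∃ j, g Φ (Φ i j).1 = (Φ i j).2).card : ℝ) <
            ((k * m : ℕ) - c * n / Real.log (2 * n)) * Fintype.card (Fin m → Fin k → Fin n × Bool) := by
  obtain ⟨k₀, hk₀⟩ := lipschitzMapsFail_of_noStableSection hNo
  refine ⟨k₀, fun k hk => ?_⟩
  obtain ⟨η, hη, ν, hν, c, hc, hev⟩ := hk₀ k hk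
  refine ⟨η, hη, c, hc, ?_⟩
  filter_upwards [hev] with n hn m hm g hLip
  have h := hn m hm g hLip
  -- solved ⇒ valid, and valid + invalid = all
  set bad : (Fin m → Fin k → Fin n × Bool) → Prop := fun Φ =>
    ν * m < ((Finset.univ.filter fun i : Fin m => ∀ j, g Φ (Φ i j).1 ≠ (Φ i j).2).card : ℝ)
    with hbad
  have hsplit : ((Finset.univ.filter fun Φ => bad Φ).card : ℝ) +
      ((Finset.univ.filter fun Φ => ¬ bad Φ).card : ℝ) =
        Fintype.card (Fin m → Fin k → Fin n × Bool) := by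
    rw [← Finset.card_univ]
    exact_mod_cast Finset.card_filter_add_card_filter_not (s := Finset.univ) bad
  have hsolved : ((Finset.univ.filter fun Φ : Fin m → Fin k → Fin n × Bool =>
      ∀ i, ∃ j, g Φ (Φ i j).1 = (Φ i j).2).card : ℝ) ≤
        ((Finset.univ.filter fun Φ => ¬ bad Φ).card : ℝ) := by
    refine Nat.cast_le.2 (Finset.card_le_card fun Φ hΦ => ?_)
    simp only [Finset.mem_filter, Finset.mem_univ, true_and] at hΦ ⊢
    rw [hbad, not_lt]
    have hempty : (Finset.univ.filter fun i : Fin m => ∀ j, g Φ (Φ i j).1 ≠ (Φ i j).2) = ∅ :=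
      Finset.filter_eq_empty_iff.2 fun i _ hi => by
        obtain ⟨j, hj⟩ := hΦ i
        exact hi j hj
    rw [hempty, Finset.card_empty, Nat.cast_zero]
    positivity
  have hkm : (0 : ℝ) ≤ (k * m : ℕ) := Nat.cast_nonneg _
  have h' : c * n / Real.log (2 * n) * Fintype.card (Fin m → Fin k → Fin n × Bool) <
      (k * m : ℕ) * ((Finset.univ.filter fun Φ => bad Φ).card : ℝ) := h
  nlinarith [mul_le_mul_of_nonneg_left hsolved hkm, h', hsplit]

end Summit.PneNP.PneNP.Theorems
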